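import Summits.Ventures.QEC.Census.AdditiveCertLanesSound
import Summits.Ventures.QEC.Census.AdditivePropagation
import Summits.Ventures.QEC.Census.BitsSpan
import HarnessLib

/-!
# Graph-form self-dual codes (`k = 0`) through qec-type-01's Brouwer–Zimmermann lane engine — `[[n, 0, d]]` in the kernel

Venture QEC (cell `qec`), census calibration (qec-search-5, gen 2). In GRAPH FORM (generator `u` = `X_u Z^{Γ_u}`, which
every self-dual additive code has up to a weight-preserving local Clifford change) the stabilizer element of a vertex set
`U` has `x`-part `𝟙_U`, so its weight is `≥ |U|` and only the sets with `|U| ≤ d − 1` need visiting — a selection-of-rows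
enumeration, i.e. exactly what qec-type-01's lane engine replays (`Census/CertBZPlane*.lean`, `segOK`,
`reaches_of_segList`). `AddCert.graphRows3 c` (definition): row `u` ↦ `x_u ‖ z_u ‖ (x_u ⊕ z_u)` (three `n`-bit fields);
the XOR over `U` is `𝟙_U ‖ z_U ‖ (𝟙_U ⊕ z_U)` of popcount `|x| + |z| + |x ⊕ z| = 2·wt`, so type-01's threshold
`wtGt (2d − 1)` reads `wt ≥ d`. `AddCert.graphOK c` (definition): `|rows| = n`, row `u` has `x`-part `2^u`, `z`-part
`< 2^n`. SOUNDNESS `AddCert.isAdditiveCode_zero_of_graph`: `checkStructureL` + `graphOK` +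
`Reaches (bzLeaf (2d−1) []) (rowPos c.graphRows3 0) (d−1) 0 0` ⇒ `IsAdditiveCode c.code 0 c.d` (+ `AdditiveCodeExists`,
`PureAdditiveCodeExists`). Use: `theorem sᵢ : segOK (3n) (2d−1) [] c.graphRows3 (d−1) m₀ s 0 = true := by decide +kernel`
per segment, then `reaches_of_segList … (by decide) …` (controls: the census files `Census/Additive/CRSSLowerGraph*`). Standard axioms.
-/

set_option autoImplicit false

namespace Summit.Ventures.QEC.Census

open Literature.InformationTheory.QuantumCodes Plane List

namespace AddCert

variable (c : AddCert)

/-- The three-field row encoding of a (graph-form) certificate: row `u` ↦ `x_u ||| z_u <<< n ||| (x_u ^^^ z_u) <<< 2n`.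
(definition) -/
def graphRows3 : List ℕ :=
  c.rows.map fun r => r.1 ||| (r.2 <<< c.n) ||| ((r.1 ^^^ r.2) <<< (2 * c.n))

/-- Graph form: `|rows| = n`, and row `u` is `X_u Z^{Γ_u}` — `x`-part `2^u`, `z`-part below `2^n`. (definition) -/
def graphOK : Bool :=
  (c.rows.length == c.n) &&
    (List.range c.n).all fun u => ((c.rows.getD u (0, 0)).1 == 2 ^ u) && decide ((c.rows.getD u (0, 0)).2 < 2 ^ c.n)

end AddCert

/-! ## Word facts -/

/-- `popc n` depends only on the bits below `n`. -/
theorem popc_congr_low (n : ℕ) : ∀ (x y : ℕ), (∀ i < n, x.testBit i = y.testBit i) → popc n x = popc n y := by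
  induction n with
  | zero => intro x y _; simp [popc]
  | succ n ih =>
    intro x y h
    rw [popc_succ_high, popc_succ_high, ih x y (fun i hi => h i (by omega)), h n (by omega)]

/-- The three-field packing of two `n`-bit words. (used only in proofs) -/
def pack3 (n a b : ℕ) : ℕ := a ||| (b <<< n) ||| ((a ^^^ b) <<< (2 * n))

/-- Bit layout of `pack3` for `a, b < 2^n`. -/
theorem testBit_pack3 (n a b : ℕ) (ha : a < 2 ^ n) (hb : b < 2 ^ n) (q : ℕ) :
    (pack3 n a b).testBit q =
      if q < n then a.testBit q else if q < 2 * n then b.testBit (q - n) else (a ^^^ b).testBit (q - 2 * n) := by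
  rw [pack3, Nat.testBit_lor, Nat.testBit_lor, Nat.testBit_shiftLeft, Nat.testBit_shiftLeft]
  by_cases h1 : q < n
  · have h2 : ¬ q ≥ n := by omega
    have h3 : ¬ q ≥ 2 * n := by omega
    simp [h1, h2, h3]
  · by_cases h2 : q < 2 * n
    · have h3 : q ≥ n := by omega
      have h4 : ¬ q ≥ 2 * n := by omega
      have h5 : a.testBit q = false := Nat.testBit_lt_two_pow (lt_of_lt_of_le ha (Nat.pow_le_pow_right (by norm_num) (by omega)))
      simp [h1, h2, h3, h4, h5]
    · have h3 : q ≥ n := by omega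
      have h4 : q ≥ 2 * n := by omega
      have h5 : a.testBit q = false := Nat.testBit_lt_two_pow (lt_of_lt_of_le ha (Nat.pow_le_pow_right (by norm_num) (by omega)))
      have h6 : b.testBit (q - n) = false := Nat.testBit_lt_two_pow (lt_of_lt_of_le hb (Nat.pow_le_pow_right (by norm_num) (by omega)))
      simp [h1, h2, h3, h4, h5, h6]

/-- `pack3` is additive (for words below `2^n`). -/
theorem pack3_xor (n a b a' b' : ℕ) (ha : a < 2 ^ n) (hb : b < 2 ^ n) (ha' : a' < 2 ^ n) (hb' : b' < 2 ^ n) :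
    pack3 n (a ^^^ a') (b ^^^ b') = pack3 n a b ^^^ pack3 n a' b' := by
  apply Nat.eq_of_testBit_eq
  intro q
  rw [Nat.testBit_xor, testBit_pack3 n _ _ (Nat.xor_lt_two_pow ha ha') (Nat.xor_lt_two_pow hb hb'),
    testBit_pack3 n a b ha hb, testBit_pack3 n a' b' ha' hb']
  by_cases h1 : q < n
  · simp [h1]
  · by_cases h2 : q < 2 * n
    · simp [h1, h2]
    · simp only [h1, h2, if_false, Nat.testBit_xor]
      cases a.testBit (q - 2 * n) <;> cases b.testBit (q - 2 * n) <;> cases a'.testBit (q - 2 * n) <;>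
        cases b'.testBit (q - 2 * n) <;> rfl

/-- `pack3 n 0 0 = 0`. -/
theorem pack3_zero (n : ℕ) : pack3 n 0 0 = 0 := by simp [pack3]

/-- A packed word has `3n` bits. -/
theorem pack3_lt (n a b : ℕ) (ha : a < 2 ^ n) (hb : b < 2 ^ n) : pack3 n a b < 2 ^ (3 * n) := by
  apply Nat.lt_pow_two_of_testBit
  intro i hi
  rw [testBit_pack3 n a b ha hb]
  have h1 : ¬ i < n := by omega
  have h2 : ¬ i < 2 * n := by omega
  rw [if_neg h1, if_neg h2]
  exact Nat.testBit_lt_two_pow (lt_of_lt_of_le (Nat.xor_lt_two_pow ha hb) (Nat.pow_le_pow_right (by norm_num) (by omega)))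

/-- **The popcount of a packed word is twice the symplectic weight**: `|a| + |b| + |a ⊕ b| = 2·|a ∨ b|`. -/
theorem popc_pack3 (n a b : ℕ) (ha : a < 2 ^ n) (hb : b < 2 ^ n) :
    popc (3 * n) (pack3 n a b) = 2 * bitCount n (a ||| b) := by
  have e3 : 3 * n = n + n + n := by ring
  rw [e3, popc_add (n + n) n, popc_add n n, ← Nat.shiftRight_eq_div_pow, ← Nat.shiftRight_eq_div_pow,
    ← Nat.shiftRight_add]
  have hA : popc n (pack3 n a b) = popc n a :=
    popc_congr_low n _ _ fun i hi => by rw [testBit_pack3 n a b ha hb, if_pos hi]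
  have hB : popc n (pack3 n a b >>> n) = popc n b :=
    popc_congr_low n _ _ fun i hi => by
      rw [Nat.testBit_shiftRight, testBit_pack3 n a b ha hb]
      have h1 : ¬ n + i < n := by omega
      have h2 : n + i < 2 * n := by omega
      rw [if_neg h1, if_pos h2, show n + i - n = i by omega]
  have hC : popc n (pack3 n a b >>> (n + n)) = popc n (a ^^^ b) :=
    popc_congr_low n _ _ fun i hi => by
      rw [Nat.testBit_shiftRight, testBit_pack3 n a b ha hb]
      have h1 : ¬ n + n + i < n := by omega
      have h2 : ¬ n + n + i < 2 * n := by omega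
      rw [if_neg h1, if_neg h2, show n + n + i - 2 * n = i by omega]
  rw [hA, hB, hC, Summit.Ventures.QEC.census_popc_eq_bitCount, Summit.Ventures.QEC.census_popc_eq_bitCount,
    Summit.Ventures.QEC.census_popc_eq_bitCount, bitCount_eq_sum, bitCount_eq_sum, bitCount_eq_sum, bitCount_eq_sum,
    Finset.mul_sum, ← Finset.sum_add_distrib, ← Finset.sum_add_distrib]
  refine Finset.sum_congr rfl fun i _ => ?_
  rw [Nat.testBit_xor, Nat.testBit_lor]
  cases a.testBit i <;> cases b.testBit i <;> rfl

/-- `bitCount` is monotone under `|||` in the first argument. -/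
theorem bitCount_le_bitCount_lor (n a b : ℕ) : bitCount n a ≤ bitCount n (a ||| b) := by
  rw [bitCount_eq_sum, bitCount_eq_sum]
  refine Finset.sum_le_sum fun i _ => ?_
  rw [Nat.testBit_lor]
  cases a.testBit i <;> cases b.testBit i <;> simp

/-! ## Coefficient numerals versus bit lists -/

/-- The list of set bits of `u` below `m` (increasing). (used only in proofs) -/
def bitsOf (m u : ℕ) : List ℕ := (List.range m).filter fun j => u.testBit j

/-- `xorPairs` over a numeral = the XORs over its set bits (both components), with an index offset. -/
theorem xorPairs_eq_bits : ∀ (rows : List (ℕ × ℕ)) (u : ℕ),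
    xorPairs rows u =
      (xorList ((bitsOf rows.length u).map fun j => (rows.getD j (0, 0)).1),
       xorList ((bitsOf rows.length u).map fun j => (rows.getD j (0, 0)).2))
  | [], u => by simp [xorPairs, bitsOf, xorList]
  | r :: rest, u => by
    have ih := xorPairs_eq_bits rest (u / 2)
    have hb : bitsOf (r :: rest).length u =
        (if u.testBit 0 then [0] else []) ++ (bitsOf rest.length (u / 2)).map (· + 1) := by
      rw [bitsOf, List.length_cons, List.range_succ_eq_map, List.filter_cons, bitsOf, List.filter_map]
      have : ((fun j => u.testBit j) ∘ fun x => x + 1) = fun j => (u / 2).testBit j := by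
        funext j; simp [Function.comp, Nat.testBit_succ]
      rw [this]
      split <;> simp
    rw [xorPairs, hb]
    by_cases h0 : u.testBit 0 = true
    · rw [if_pos h0, if_pos h0, ih]
      simp [xorList, List.map_map, Function.comp_def]
    · rw [if_neg h0, if_neg h0, ih]
      simp [List.map_map, Function.comp_def]

/-- `bitsOf` lists indices `< m`, increasingly, without repetition. -/
theorem bitsOf_sublist (m u : ℕ) : (bitsOf m u).Sublist (List.range m) := List.filter_sublist

/-- Membership in `bitsOf`. -/
theorem mem_bitsOf {m u j : ℕ} : j ∈ bitsOf m u ↔ j < m ∧ u.testBit j = true := by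
  simp [bitsOf, List.mem_filter, List.mem_range]

/-- A fresh bit raises `bitCount` by one. -/
theorem bitCount_two_pow_xor (n j R : ℕ) (hj : j < n) (hR : R.testBit j = false) :
    bitCount n (2 ^ j ^^^ R) = bitCount n R + 1 := by
  rw [bitCount_eq_card, bitCount_eq_card]
  have : (Finset.univ.filter fun i : Fin n => (2 ^ j ^^^ R).testBit i = true) =
      insert ⟨j, hj⟩ (Finset.univ.filter fun i : Fin n => R.testBit i = true) := by
    ext i
    simp only [Finset.mem_filter, Finset.mem_univ, true_and, Finset.mem_insert, Nat.testBit_xor,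
      Nat.testBit_two_pow]
    by_cases hij : i = ⟨j, hj⟩
    · subst hij; simp [hR]
    · have : j ≠ i.1 := fun h => hij (Fin.ext h.symm)
      simp [this, hij]
  rw [this, Finset.card_insert_of_notMem]
  simp [hR]

/-- **The XOR of distinct powers of two has as many set bits as there are powers.** -/
theorem bitCount_xorList_pow (n : ℕ) : ∀ (J : List ℕ), J.Nodup → (∀ j ∈ J, j < n) →
    bitCount n (xorList (J.map fun j => 2 ^ j)) = J.length
  | [], _, _ => by simp [xorList, bitCount_eq_sum]
  | j :: J, hnd, hlt => by
    rw [List.map_cons, xorList, List.length_cons]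
    have hj : j < n := hlt j (by simp)
    have hnd' : J.Nodup := (List.nodup_cons.1 hnd).2
    have hjJ : j ∉ J := (List.nodup_cons.1 hnd).1
    have ih := bitCount_xorList_pow n J hnd' (fun i hi => hlt i (List.mem_cons_of_mem _ hi))
    have hR : (xorList (J.map fun j => 2 ^ j)).testBit j = false := by
      -- bit `j` of the XOR of the other powers is clear
      suffices h : ∀ (L : List ℕ), j ∉ L → (xorList (L.map fun j => 2 ^ j)).testBit j = false from h J hjJ
      intro L hL
      induction L with
      | nil => simp [xorList]
      | cons a L ihL =>
        rw [List.map_cons, xorList, Nat.testBit_xor, ihL (fun h => hL (List.mem_cons_of_mem _ h)),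
          Nat.testBit_two_pow]
        have : a ≠ j := fun h => hL (h ▸ List.mem_cons_self)
        simp [this]
    rw [bitCount_two_pow_xor n j _ hj hR, ih]

/-! ## Span membership as a coefficient numeral (type-02's `xorPairs`) -/

/-- `xorRows` on the component functions of a row list is `xorPairs` (same recursion). -/
theorem xorRows_eq_xorPairs : ∀ (rows : List (ℕ × ℕ)) (u : ℕ),
    (Summit.Ventures.QEC.xorRows (fun i : Fin rows.length => (rows[i]).1) u,
     Summit.Ventures.QEC.xorRows (fun i : Fin rows.length => (rows[i]).2) u) = xorPairs rows u
  | [], u => by simp [Summit.Ventures.QEC.xorRows, xorPairs]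
  | r :: rest, u => by
    have ih := xorRows_eq_xorPairs rest (u / 2)
    have e1 := congrArg Prod.fst ih
    have e2 := congrArg Prod.snd ih
    rw [xorPairs]
    simp only [List.length_cons, Summit.Ventures.QEC.xorRows, Fin.getElem_fin, Fin.val_zero, List.getElem_cons_zero,
      Fin.val_succ, List.getElem_cons_succ]
    simp only [Fin.getElem_fin] at e1 e2
    rw [e1, e2]
    by_cases h : u.testBit 0 = true
    · simp [h]
    · simp [h]

namespace AddCert

variable (c : AddCert)

/-- **Every element of the code is the combination of some coefficient numeral** `u < 2^{|rows|}`. -/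
theorem exists_xorPairs_of_mem_code {v : SympVec c.n} (hv : v ∈ c.code) :
    ∃ u, u < 2 ^ c.rows.length ∧ ofBitPair c.n (xorPairs c.rows u).1 (xorPairs c.rows u).2 = v := by
  have h := (Summit.Ventures.QEC.mem_span_range_ofBitPair_iff (n := c.n)
    (fun i : Fin c.rows.length => (c.rows[i]).1) (fun i : Fin c.rows.length => (c.rows[i]).2) v).1 hv
  obtain ⟨u, hu, huv⟩ := h
  refine ⟨u, hu, ?_⟩
  have e := xorRows_eq_xorPairs c.rows u
  rw [← huv, ← congrArg Prod.fst e, ← congrArg Prod.snd e]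

/-! ## Graph form -/

/-- Unpacking `graphOK`. -/
theorem graphOK_spec (hg : c.graphOK = true) :
    c.rows.length = c.n ∧ ∀ u < c.n, (c.rows.getD u (0, 0)).1 = 2 ^ u ∧ (c.rows.getD u (0, 0)).2 < 2 ^ c.n := by
  simp only [graphOK, Bool.and_eq_true, beq_iff_eq, List.all_eq_true, List.mem_range, decide_eq_true_eq] at hg
  exact ⟨hg.1, fun u hu => hg.2 u hu⟩

/-- Length of the three-field row list. -/
theorem length_graphRows3 : c.graphRows3.length = c.rows.length := by simp [graphRows3]

/-- Entry `j` of the three-field row list. -/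
theorem getD_graphRows3 (j : ℕ) (hj : j < c.rows.length) :
    c.graphRows3.getD j 0 = pack3 c.n (c.rows.getD j (0, 0)).1 (c.rows.getD j (0, 0)).2 := by
  rw [graphRows3, List.getD_eq_getElem _ _ (by simpa using hj), List.getElem_map, List.getD_eq_getElem _ _ hj, pack3]

/-- In graph form, the XOR of the three-field rows over an index list below `n` is the packing of the XORs of the
components. -/
theorem xorList_graphRows3 (hg : c.graphOK = true) : ∀ (J : List ℕ), (∀ j ∈ J, j < c.n) →
    xorList (J.map fun j => c.graphRows3.getD j 0) =
      pack3 c.n (xorList (J.map fun j => (c.rows.getD j (0, 0)).1)) (xorList (J.map fun j => (c.rows.getD j (0, 0)).2)) ∧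
    xorList (J.map fun j => (c.rows.getD j (0, 0)).1) < 2 ^ c.n ∧
    xorList (J.map fun j => (c.rows.getD j (0, 0)).2) < 2 ^ c.n
  | [], _ => by simp [xorList, pack3_zero]
  | j :: J, hJ => by
    obtain ⟨hlen, hrows⟩ := c.graphOK_spec hg
    have hj : j < c.n := hJ j (by simp)
    obtain ⟨ih, hx, hz⟩ := xorList_graphRows3 hg J (fun i hi => hJ i (List.mem_cons_of_mem _ hi))
    have hxj : (c.rows.getD j (0, 0)).1 < 2 ^ c.n := by
      rw [(hrows j hj).1]; exact Nat.pow_lt_pow_right (by norm_num) hj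
    have hzj : (c.rows.getD j (0, 0)).2 < 2 ^ c.n := (hrows j hj).2
    simp only [List.map_cons, xorList]
    refine ⟨?_, Nat.xor_lt_two_pow hxj hx, Nat.xor_lt_two_pow hzj hz⟩
    rw [ih, c.getD_graphRows3 j (by rw [hlen]; exact hj), ← pack3_xor _ _ _ _ _ hxj hzj hx hz]

/-- In graph form the `x`-components over `J` are the distinct powers `2^j`. -/
theorem map_fst_eq_pow (hg : c.graphOK = true) (J : List ℕ) (hJ : ∀ j ∈ J, j < c.n) :
    (J.map fun j => (c.rows.getD j (0, 0)).1) = J.map fun j => 2 ^ j := by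
  refine List.map_congr_left fun j hj => ?_
  exact ((c.graphOK_spec hg).2 j (hJ j hj)).1

/-- All three-field rows are below `2^{3n}` (hypothesis `hG` of type-01's `reaches_of_segList`). -/
theorem graphRows3_lt (hg : c.graphOK = true) : ∀ g ∈ c.graphRows3, g < 2 ^ (3 * c.n) := by
  intro g hgm
  rw [graphRows3, List.mem_map] at hgm
  obtain ⟨r, hr, rfl⟩ := hgm
  obtain ⟨hlen, hrows⟩ := c.graphOK_spec hg
  obtain ⟨i, hi, rfl⟩ := List.getElem_of_mem hr
  have hi' : i < c.n := by rw [← hlen]; exact hi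
  have h1 := (hrows i hi').1
  have h2 := (hrows i hi').2
  rw [List.getD_eq_getElem _ _ hi] at h1 h2
  have hx : (c.rows[i]).1 < 2 ^ c.n := by rw [h1]; exact Nat.pow_lt_pow_right (by norm_num) hi'
  exact pack3_lt c.n _ _ hx h2

/-- **SOUNDNESS, graph form**: structural checks + graph form + the conclusion of type-01's lane replay on the
three-field rows (`Reaches (bzLeaf (2d−1) []) (rowPos c.graphRows3 0) (d−1) 0 0`) ⇒ `[[n, 0, d]]`: every nonzero
stabilizer has weight `≥ d`. -/
theorem isAdditiveCode_zero_of_graph (hs : c.checkStructureL = true) (hg : c.graphOK = true)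
    (hreach : Reaches (bzLeaf (2 * c.d - 1) []) (rowPos c.graphRows3 0) (c.d - 1) 0 0) :
    IsAdditiveCode c.code 0 c.d := by
  obtain ⟨hlen, hrows⟩ := c.graphOK_spec hg
  rw [checkStructureL, Bool.and_eq_true] at hs
  have hs' := hs.1
  simp only [checkStructure, Bool.and_eq_true, decide_eq_true_eq] at hs'
  obtain ⟨⟨⟨hcomm, hind⟩, -⟩, -⟩ := hs'
  have hso := c.isSelfOrthogonal_code hcomm
  have hdim := c.finrank_code hind
  have hSS : sympDual c.code = c.code := by
    refine (Submodule.eq_of_le_of_finrank_le hso ?_).symm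
    have := finrank_sympDual_add c.code
    omega
  refine ⟨hso, by rw [hdim, hlen, Nat.add_zero], fun w hw hw' => absurd (hSS ▸ hw) hw', fun _ v hv hv0 => ?_⟩
  -- write `v` as the combination with coefficient numeral `u`
  obtain ⟨u, hu, rfl⟩ := c.exists_xorPairs_of_mem_code hv
  set J := bitsOf c.rows.length u with hJdef
  have hJlt : ∀ j ∈ J, j < c.n := fun j hj => by rw [← hlen]; exact (mem_bitsOf.1 hj).1
  have hJnd : J.Nodup := (bitsOf_sublist _ _).nodup List.nodup_range
  have hXZ := xorPairs_eq_bits c.rows u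
  rw [← hJdef] at hXZ
  set X := xorList (J.map fun j => (c.rows.getD j (0, 0)).1) with hX
  set Z := xorList (J.map fun j => (c.rows.getD j (0, 0)).2) with hZ
  have hvXZ : xorPairs c.rows u = (X, Z) := hXZ
  rw [hvXZ]
  show c.d ≤ sympWeight (ofBitPair c.n X Z)
  rw [show ofBitPair c.n X Z = ofBitPair c.n (X, Z).1 (X, Z).2 from rfl, sympWeight_ofBitPair_eq_pw, pw]
  show c.d ≤ bitCount c.n (X ||| Z)
  -- the `x`-numeral has `|J|` set bits
  have hXpow : X = xorList (J.map fun j => 2 ^ j) := by rw [hX, c.map_fst_eq_pow hg J hJlt]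
  have hXcnt : bitCount c.n X = J.length := by rw [hXpow]; exact bitCount_xorList_pow c.n J hJnd hJlt
  by_cases hbig : c.d ≤ J.length
  · -- many rows selected: the `x`-part alone has weight `≥ d`
    calc c.d ≤ J.length := hbig
      _ = bitCount c.n X := hXcnt.symm
      _ ≤ bitCount c.n (X ||| Z) := bitCount_le_bitCount_lor _ _ _
  · -- few rows: the lane replay saw this selection
    have hJne : J ≠ [] := by
      intro hJ0
      apply hv0
      rw [hvXZ, hX, hZ, hJ0]
      simp [xorList, ofBitPair_zero]
    obtain ⟨hpack, hXlt, hZlt⟩ := c.xorList_graphRows3 hg J hJlt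
    set S := J.map fun j => (2 ^ j, c.graphRows3.getD j 0) with hSdef
    have hSsub : S.Sublist (rowPos c.graphRows3 0) := by
      rw [rowPos_zero, c.length_graphRows3, hSdef, hJdef]
      exact (bitsOf_sublist _ _).map _
    have hSlen : S.length ≤ c.d - 1 := by rw [hSdef, List.length_map]; omega
    have hleaf := hreach S hSsub hSlen
    rw [Nat.zero_xor, Nat.zero_xor, hSdef, xorFst_map_pair, xorSnd_map_pair, ← hXpow, hpack, bzLeaf] at hleaf
    have hX0 : (X == 0) = false := by
      rw [beq_eq_false_iff_ne]
      intro h0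
      have h1 : bitCount c.n X = 0 := by rw [h0]; simp [bitCount_eq_sum]
      rw [hXcnt] at h1
      exact hJne (List.eq_nil_of_length_eq_zero h1)
    rw [hX0, Bool.false_or, List.elem_nil, Bool.or_false] at hleaf
    have hgt := lt_popc_of_wtGt (3 * c.n) _ _ (pack3_lt c.n X Z hXlt hZlt) hleaf
    rw [popc_pack3 c.n X Z hXlt hZlt] at hgt
    omega

/-- **`[[n, 0, d]]` exists** (graph form through the lane engine). -/
theorem additiveCodeExists_zero_of_graph (hs : c.checkStructureL = true) (hg : c.graphOK = true)
    (hreach : Reaches (bzLeaf (2 * c.d - 1) []) (rowPos c.graphRows3 0) (c.d - 1) 0 0) :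
    AdditiveCodeExists c.n 0 c.d :=
  ⟨c.code, c.isAdditiveCode_zero_of_graph hs hg hreach⟩

/-- **A pure `[[n, 0, d]]` exists** (graph form; `k = 0` codes are pure by convention). -/
theorem pureAdditiveCodeExists_zero_of_graph (hs : c.checkStructureL = true) (hg : c.graphOK = true)
    (hreach : Reaches (bzLeaf (2 * c.d - 1) []) (rowPos c.graphRows3 0) (c.d - 1) 0 0) :
    PureAdditiveCodeExists c.n 0 c.d :=
  pureAdditiveCodeExists_of_zero (c.additiveCodeExists_zero_of_graph hs hg hreach)

end AddCert

end Summit.Ventures.QEC.Census
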